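import Summits.ValiantsHypothesis.ValiantsHypothesis.Theorems.LacunarySymmetroidMatrixDescartesPivotRankOneOneThreeKillEight
import Summits.ValiantsHypothesis.ValiantsHypothesis.Theorems.LacunarySymmetroidMatrixDescartesPivotRankOneOneThreeKillEightPairs

/-!
# `MatrixDescartes` census — rank-one `(2,4)₁`, split 1/3, chamber (C): the WEIGHT-FREE circuit pair «N12 ∨ C₃»

HONEST FRAMING.  Object-search cell `pub-symmetroid`, seat `val-sym-mdr-p1` (generation 16); helper file `--supports` the crux item
stmt-ValiantsHypothesis-18050 (`Theses.LacunarySymmetroid.MatrixDescartes`, OPEN, on HOLD) with NO closure claim.  A conditional kernel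
theorem («condition ⇒ Z₊ ≤ 8») for chamber (C) of the 1/3 split `d₀ < e < d₁ < d₂ < d₃` (degree order
`s₀ p₀₁ c p₀₂ s₁ p₀₃ s₂ p₁₂ s₃ p₁₃ p₂₃`, Descartes-with-parity `9`); no covering theorem for (C) is claimed.  Nothing here bears on
`MatrixDescartes` in its window, on `DoorA26` / `DoorA34`, registers / credences, or `VP ≠ VNP`.

WHAT IS NEW.  The two kernel circuits across the translated quadruple `{s₂, p₁₂, s₃, p₁₃}` (`p₁₂ − s₂ = p₁₃ − s₃ = d₁ − e`),
namely (N12) on `(s₂, p₁₂, s₃)` (`…KillEightPairs`, pattern `(−,+,−)`) and (C₃) on `(p₁₂, s₃, p₁₃)` (`…OneThreeKillEight`, pattern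
`(+,−,+)`), have the SAME gaps `p = d₁ − e`, `q = e + d₃ − d₁ − d₂` and OPPOSITE weight normals: in log-weights `l = log w` the first
reads `n·l < c₁`, the second `−n·l < c₂` with `n = (0, p+q, p, −p)`.  Hence whenever `c₁ + c₂ > 0` one of the two applies for EVERY
choice of weights: the product of the two circuit inequalities is weight-free (the factor `(w₁w₂w₃)^{p+q}` cancels), and
«product inequality ⇒ Z₊ ≤ 8» (`elevenNomial_chamberC_N12C3_le_eight`, matrix form `oneThree_rankOne_posRoots_le_eight_of_N12C3`).  In
the hyperbolic normal form the condition reads `σ₁₂^q · R₁(exps) < σ₁₃^q · R₂(exps)` (letters `1,2` closer than `1,3` by an exponent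
factor) — a fifteenth weight-free certificate for (C), the first built from circuits rather than a translated-pair four-nomial; it is the
two-element extreme ray of the Farkas cone of the eight chamber-(C) circuit normals (seat memo, §Farkas census), the ray active at the
located hardest corner of the fifteen-certificate cover.

[folklore] Only real-number bookkeeping on top of the two cited kernel theorems.  No definitions, no named facts.
-/

-- `Summit.ValiantsHypothesis.ValiantsHypothesis.…` repeats a component by the D-0017 layout
-- (single-conjunct summit), which the `dupNamespace` linter flags; the name is mandated.
set_option linter.dupNamespace false

namespace Summit.ValiantsHypothesis.ValiantsHypothesis.Theorems.LacunarySymmetroidMatrixDescartes.Pivot.TwoDirections.BlockLaw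

open Polynomial Matrix Finset
open scoped BigOperators

/-- **Circuit pair «N12 ∨ C₃» of chamber (C), real form.**  If the PRODUCT of the (N12) and (C₃) circuit inequalities holds — a condition in
which the weights `w₁, w₂, w₃` cancel (stated here in the cancelled, weight-free form) — then one of the two circuits applies and `Z₊ ≤ 8`:
either (N12) holds, or it fails and then, multiplying its failure against the product inequality, (C₃) holds. -/
theorem elevenNomial_chamberC_N12C3_le_eight (e d₀ d₁ d₂ d₃ : ℕ) (h0e : d₀ < e) (he1 : e < d₁) (h12 : d₁ < d₂) (h23 : d₂ < d₃)
    (hC1 : d₀ + d₁ < 2 * e) (hC2 : 2 * e < d₀ + d₂) (hC3 : d₀ + d₂ < e + d₁) (hC4 : e + d₁ < d₀ + d₃) (hC5 : d₀ + d₃ < e + d₂) (hC6 : d₁ + d₂ < e + d₃)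
    (dJ m₀ m₁ m₂ m₃ w₀ w₁ w₂ w₃ D01 D02 D03 D12 D13 D23 : ℝ) (hw₁ : 0 < w₁) (hw₂ : 0 < w₂) (hw₃ : 0 < w₃) (hm₂ : m₂ < 0) (hm₃ : m₃ < 0)
    (hD12 : 0 < D12) (hD13 : 0 < D13)
    (hpair : ((D12 * (((d₁ : ℝ) + d₂ - 2 * e) * ((d₁ : ℝ) + d₂ - e - d₀) * ((d₂ : ℝ) - e) * ((d₂ : ℝ) - d₀) * ((d₁ : ℝ) - d₀) * ((d₁ : ℝ) + d₂ - d₀ - d₃) * ((d₃ : ℝ) - d₂) * ((d₃ : ℝ) - d₁))) ^ (d₁ - e + (e + d₃ - (d₁ + d₂)))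
          * ((((e + d₃ - (d₁ + d₂) : ℕ) : ℝ)) ^ (e + d₃ - (d₁ + d₂)) * (((d₁ - e : ℕ) : ℝ)) ^ (d₁ - e)))
        * (((-m₃) * (((d₃ : ℝ) - e) * ((d₃ : ℝ) - d₀) * ((d₃ : ℝ) - d₁) * ((d₃ : ℝ) - d₂) * ((e : ℝ) + d₃ - d₀ - d₁) * ((e : ℝ) + d₃ - d₀ - d₂) * ((e : ℝ) - d₀) * ((d₂ : ℝ) - e))) ^ (d₁ - e + (e + d₃ - (d₁ + d₂)))
          * ((((e + d₃ - (d₁ + d₂) : ℕ) : ℝ)) ^ (e + d₃ - (d₁ + d₂)) * (((d₁ - e : ℕ) : ℝ)) ^ (d₁ - e)))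
      < ((((d₁ - e + (e + d₃ - (d₁ + d₂)) : ℕ) : ℝ)) ^ (d₁ - e + (e + d₃ - (d₁ + d₂)))
          * (((-m₂) * (((d₂ : ℝ) - e) * ((d₂ : ℝ) - d₀) * ((d₂ : ℝ) - d₁) * ((e : ℝ) + d₂ - d₀ - d₁) * ((e : ℝ) - d₀) * ((e : ℝ) + d₂ - d₀ - d₃) * ((d₁ : ℝ) + d₃ - e - d₂) * ((d₃ : ℝ) - e))) ^ (e + d₃ - (d₁ + d₂))
            * ((-m₃) * (((d₃ : ℝ) - e) * ((d₃ : ℝ) - d₀) * ((d₃ : ℝ) - d₁) * ((e : ℝ) + d₃ - d₀ - d₁) * ((e : ℝ) + d₃ - d₀ - d₂) * ((e : ℝ) - d₀) * ((d₁ : ℝ) - e) * ((d₂ : ℝ) - e))) ^ (d₁ - e)))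
        * ((((d₁ - e + (e + d₃ - (d₁ + d₂)) : ℕ) : ℝ)) ^ (d₁ - e + (e + d₃ - (d₁ + d₂)))
          * ((D12 * (((d₁ : ℝ) + d₂ - 2 * e) * ((d₁ : ℝ) + d₂ - e - d₀) * ((d₂ : ℝ) - e) * ((d₁ : ℝ) - e) * ((d₂ : ℝ) - d₀) * ((d₁ : ℝ) - d₀) * ((d₁ : ℝ) + d₂ - d₀ - d₃) * ((d₃ : ℝ) - d₁))) ^ (d₁ - e)
            * (D13 * (((d₁ : ℝ) + d₃ - 2 * e) * ((d₁ : ℝ) + d₃ - e - d₀) * ((d₃ : ℝ) - e) * ((d₁ : ℝ) + d₃ - e - d₂) * ((d₃ : ℝ) - d₀) * ((d₁ : ℝ) + d₃ - d₀ - d₂) * ((d₁ : ℝ) - d₀) * ((d₂ : ℝ) - d₁))) ^ (e + d₃ - (d₁ + d₂))))) :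
    ((∑ i : Fin 11, Polynomial.C ((![dJ, w₀ * m₀, w₁ * m₁, w₂ * m₂, w₃ * m₃, w₀ * w₁ * D01, w₀ * w₂ * D02, w₀ * w₃ * D03, w₁ * w₂ * D12, w₁ * w₃ * D13, w₂ * w₃ * D23] : Fin 11 → ℝ) i) * X ^ ((![2 * e, e + d₀, e + d₁, e + d₂, e + d₃, d₀ + d₁, d₀ + d₂, d₀ + d₃, d₁ + d₂, d₁ + d₃, d₂ + d₃] : Fin 11 → ℕ) i)).roots.toFinset.filter (fun t => 0 < t)).card ≤ 8 := by
  classical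
  by_cases hN : (w₁ * w₂ * D12 * (((d₁ : ℝ) + d₂ - 2 * e) * ((d₁ : ℝ) + d₂ - e - d₀) * ((d₂ : ℝ) - e) * ((d₂ : ℝ) - d₀) * ((d₁ : ℝ) - d₀) * ((d₁ : ℝ) + d₂ - d₀ - d₃) * ((d₃ : ℝ) - d₂) * ((d₃ : ℝ) - d₁))) ^ (d₁ - e + (e + d₃ - (d₁ + d₂))) * ((((e + d₃ - (d₁ + d₂) : ℕ) : ℝ)) ^ (e + d₃ - (d₁ + d₂)) * (((d₁ - e : ℕ) : ℝ)) ^ (d₁ - e))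
      < (((d₁ - e + (e + d₃ - (d₁ + d₂)) : ℕ) : ℝ)) ^ (d₁ - e + (e + d₃ - (d₁ + d₂))) * ((w₂ * (-m₂) * (((d₂ : ℝ) - e) * ((d₂ : ℝ) - d₀) * ((d₂ : ℝ) - d₁) * ((e : ℝ) + d₂ - d₀ - d₁) * ((e : ℝ) - d₀) * ((e : ℝ) + d₂ - d₀ - d₃) * ((d₁ : ℝ) + d₃ - e - d₂) * ((d₃ : ℝ) - e))) ^ (e + d₃ - (d₁ + d₂)) * (w₃ * (-m₃) * (((d₃ : ℝ) - e) * ((d₃ : ℝ) - d₀) * ((d₃ : ℝ) - d₁) * ((e : ℝ) + d₃ - d₀ - d₁) * ((e : ℝ) + d₃ - d₀ - d₂) * ((e : ℝ) - d₀) * ((d₁ : ℝ) - e) * ((d₂ : ℝ) - e))) ^ (d₁ - e))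
  · exact elevenNomial_chamberC_N12_le_eight e d₀ d₁ d₂ d₃ h0e he1 h12 h23 hC1 hC2 hC3 hC4 hC5 hC6 dJ m₀ m₁ m₂ m₃ w₀ w₁ w₂ w₃ D01 D02
      D03 D12 D13 D23 hw₂ hw₃ hm₂ hm₃ hN
  push Not at hN
  have h0e' : (d₀ : ℝ) < e := by exact_mod_cast h0e
  have he1' : (e : ℝ) < d₁ := by exact_mod_cast he1
  have h12' : (d₁ : ℝ) < d₂ := by exact_mod_cast h12
  have h23' : (d₂ : ℝ) < d₃ := by exact_mod_cast h23
  have hC1' : (d₀ : ℝ) + d₁ < 2 * e := by exact_mod_cast hC1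
  have hC2' : 2 * (e : ℝ) < d₀ + d₂ := by exact_mod_cast hC2
  have hC3' : (d₀ : ℝ) + d₂ < e + d₁ := by exact_mod_cast hC3
  have hC4' : (e : ℝ) + d₁ < d₀ + d₃ := by exact_mod_cast hC4
  have hC5' : (d₀ : ℝ) + d₃ < e + d₂ := by exact_mod_cast hC5
  have hC6' : (d₁ : ℝ) + d₂ < e + d₃ := by exact_mod_cast hC6
  -- positivity of the three kill products that matter for the sign bookkeeping
  have hPB : 0 < ((d₁ : ℝ) + d₂ - 2 * e) * ((d₁ : ℝ) + d₂ - e - d₀) * ((d₂ : ℝ) - e) * ((d₂ : ℝ) - d₀) * ((d₁ : ℝ) - d₀) * ((d₁ : ℝ) + d₂ - d₀ - d₃) * ((d₃ : ℝ) - d₂) * ((d₃ : ℝ) - d₁) := by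
    have f1 : 0 < ((d₁ : ℝ) + d₂ - 2 * e) := by linarith
    have f2 : 0 < ((d₁ : ℝ) + d₂ - e - d₀) := by linarith
    have f3 : 0 < ((d₂ : ℝ) - e) := by linarith
    have f4 : 0 < ((d₂ : ℝ) - d₀) := by linarith
    have f5 : 0 < ((d₁ : ℝ) - d₀) := by linarith
    have f6 : 0 < ((d₁ : ℝ) + d₂ - d₀ - d₃) := by linarith
    have f7 : 0 < ((d₃ : ℝ) - d₂) := by linarith
    have f8 : 0 < ((d₃ : ℝ) - d₁) := by linarith
    exact mul_pos (mul_pos (mul_pos (mul_pos (mul_pos (mul_pos (mul_pos f1 f2) f3) f4) f5) f6) f7) f8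
  have hQA : 0 < ((d₁ : ℝ) + d₂ - 2 * e) * ((d₁ : ℝ) + d₂ - e - d₀) * ((d₂ : ℝ) - e) * ((d₁ : ℝ) - e) * ((d₂ : ℝ) - d₀) * ((d₁ : ℝ) - d₀) * ((d₁ : ℝ) + d₂ - d₀ - d₃) * ((d₃ : ℝ) - d₁) := by
    have f1 : 0 < ((d₁ : ℝ) + d₂ - 2 * e) := by linarith
    have f2 : 0 < ((d₁ : ℝ) + d₂ - e - d₀) := by linarith
    have f3 : 0 < ((d₂ : ℝ) - e) := by linarith
    have f4 : 0 < ((d₁ : ℝ) - e) := by linarith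
    have f5 : 0 < ((d₂ : ℝ) - d₀) := by linarith
    have f6 : 0 < ((d₁ : ℝ) - d₀) := by linarith
    have f7 : 0 < ((d₁ : ℝ) + d₂ - d₀ - d₃) := by linarith
    have f8 : 0 < ((d₃ : ℝ) - d₁) := by linarith
    exact mul_pos (mul_pos (mul_pos (mul_pos (mul_pos (mul_pos (mul_pos f1 f2) f3) f4) f5) f6) f7) f8
  have hQC : 0 < ((d₁ : ℝ) + d₃ - 2 * e) * ((d₁ : ℝ) + d₃ - e - d₀) * ((d₃ : ℝ) - e) * ((d₁ : ℝ) + d₃ - e - d₂) * ((d₃ : ℝ) - d₀) * ((d₁ : ℝ) + d₃ - d₀ - d₂) * ((d₁ : ℝ) - d₀) * ((d₂ : ℝ) - d₁) := by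
    have f1 : 0 < ((d₁ : ℝ) + d₃ - 2 * e) := by linarith
    have f2 : 0 < ((d₁ : ℝ) + d₃ - e - d₀) := by linarith
    have f3 : 0 < ((d₃ : ℝ) - e) := by linarith
    have f4 : 0 < ((d₁ : ℝ) + d₃ - e - d₂) := by linarith
    have f5 : 0 < ((d₃ : ℝ) - d₀) := by linarith
    have f6 : 0 < ((d₁ : ℝ) + d₃ - d₀ - d₂) := by linarith
    have f7 : 0 < ((d₁ : ℝ) - d₀) := by linarith
    have f8 : 0 < ((d₂ : ℝ) - d₁) := by linarith
    exact mul_pos (mul_pos (mul_pos (mul_pos (mul_pos (mul_pos (mul_pos f1 f2) f3) f4) f5) f6) f7) f8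
  -- the failed (N12) left side is non-negative, and the (C₃) right side is non-negative
  have hL1 : 0 ≤ (w₁ * w₂ * D12 * (((d₁ : ℝ) + d₂ - 2 * e) * ((d₁ : ℝ) + d₂ - e - d₀) * ((d₂ : ℝ) - e) * ((d₂ : ℝ) - d₀) * ((d₁ : ℝ) - d₀) * ((d₁ : ℝ) + d₂ - d₀ - d₃) * ((d₃ : ℝ) - d₂) * ((d₃ : ℝ) - d₁))) ^ (d₁ - e + (e + d₃ - (d₁ + d₂))) * ((((e + d₃ - (d₁ + d₂) : ℕ) : ℝ)) ^ (e + d₃ - (d₁ + d₂)) * (((d₁ - e : ℕ) : ℝ)) ^ (d₁ - e)) :=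
    mul_nonneg (pow_nonneg (mul_nonneg (mul_nonneg (mul_nonneg hw₁.le hw₂.le) hD12.le) hPB.le) _)
      (mul_nonneg (pow_nonneg (Nat.cast_nonneg _) _) (pow_nonneg (Nat.cast_nonneg _) _))
  have hR2 : 0 ≤ ((((e + d₃) - d₁ - d₂ + (d₁ - e) : ℕ) : ℝ)) ^ ((e + d₃) - d₁ - d₂ + (d₁ - e)) * ((w₁ * w₂ * D12 * (((d₁ : ℝ) + d₂ - 2 * e) * ((d₁ : ℝ) + d₂ - e - d₀) * ((d₂ : ℝ) - e) * ((d₁ : ℝ) - e) * ((d₂ : ℝ) - d₀) * ((d₁ : ℝ) - d₀) * ((d₁ : ℝ) + d₂ - d₀ - d₃) * ((d₃ : ℝ) - d₁))) ^ (d₁ - e) * (w₁ * w₃ * D13 * (((d₁ : ℝ) + d₃ - 2 * e) * ((d₁ : ℝ) + d₃ - e - d₀) * ((d₃ : ℝ) - e) * ((d₁ : ℝ) + d₃ - e - d₂) * ((d₃ : ℝ) - d₀) * ((d₁ : ℝ) + d₃ - d₀ - d₂) * ((d₁ : ℝ) - d₀) * ((d₂ : ℝ) - d₁))) ^ ((e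 + d₃) - d₁ - d₂)) :=
    mul_nonneg (pow_nonneg (Nat.cast_nonneg _) _)
      (mul_nonneg (pow_nonneg (mul_nonneg (mul_nonneg (mul_nonneg hw₁.le hw₂.le) hD12.le) hQA.le) _)
        (pow_nonneg (mul_nonneg (mul_nonneg (mul_nonneg hw₁.le hw₃.le) hD13.le) hQC.le) _))
  -- KEY: (failed N12 left side) · (C₃ left side) < (N12 right side) · (C₃ right side), from `hpair` times `(w₁ w₂ w₃)^{p+q}`
  have key : ((w₁ * w₂ * D12 * (((d₁ : ℝ) + d₂ - 2 * e) * ((d₁ : ℝ) + d₂ - e - d₀) * ((d₂ : ℝ) - e) * ((d₂ : ℝ) - d₀) * ((d₁ : ℝ) - d₀) * ((d₁ : ℝ) + d₂ - d₀ - d₃) * ((d₃ : ℝ) - d₂) * ((d₃ : ℝ) - d₁))) ^ (d₁ - e + (e + d₃ - (d₁ + d₂))) * ((((e + d₃ - (d₁ + d₂) : ℕ) : ℝ)) ^ (e + d₃ - (d₁ + d₂)) * (((d₁ - e : ℕ) : ℝ)) ^ (d₁ - e)))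
      * ((w₃ * (-m₃) * (((d₃ : ℝ) - e) * ((d₃ : ℝ) - d₀) * ((d₃ : ℝ) - d₁) * ((d₃ : ℝ) - d₂) * ((e : ℝ) + d₃ - d₀ - d₁) * ((e : ℝ) + d₃ - d₀ - d₂) * ((e : ℝ) - d₀) * ((d₂ : ℝ) - e))) ^ ((e + d₃) - d₁ - d₂ + (d₁ - e)) * ((((d₁ - e : ℕ) : ℝ)) ^ (d₁ - e) * ((((e + d₃) - d₁ - d₂ : ℕ) : ℝ)) ^ ((e + d₃) - d₁ - d₂)))
      < ((((d₁ - e + (e + d₃ - (d₁ + d₂)) : ℕ) : ℝ)) ^ (d₁ - e + (e + d₃ - (d₁ + d₂))) * ((w₂ * (-m₂) * (((d₂ : ℝ) - e) * ((d₂ : ℝ) - d₀) * ((d₂ : ℝ) - d₁) * ((e : ℝ) + d₂ - d₀ - d₁) * ((e : ℝ) - d₀) * ((e : ℝ) + d₂ - d₀ - d₃) * ((d₁ : ℝ) + d₃ - e - d₂) * ((d₃ : ℝ) - e))) ^ (e + d₃ - (d₁ + d₂)) * (w₃ * (-m₃) * (((d₃ : ℝ) - e) * ((d₃ : ℝ)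 - d₀) * ((d₃ : ℝ) - d₁) * ((e : ℝ) + d₃ - d₀ - d₁) * ((e : ℝ) + d₃ - d₀ - d₂) * ((e : ℝ) - d₀) * ((d₁ : ℝ) - e) * ((d₂ : ℝ) - e))) ^ (d₁ - e)))
      * (((((e + d₃) - d₁ - d₂ + (d₁ - e) : ℕ) : ℝ)) ^ ((e + d₃) - d₁ - d₂ + (d₁ - e)) * ((w₁ * w₂ * D12 * (((d₁ : ℝ) + d₂ - 2 * e) * ((d₁ : ℝ) + d₂ - e - d₀) * ((d₂ : ℝ) - e) * ((d₁ : ℝ) - e) * ((d₂ : ℝ) - d₀) * ((d₁ : ℝ) - d₀) * ((d₁ : ℝ) + d₂ - d₀ - d₃) * ((d₃ : ℝ) - d₁))) ^ (d₁ - e) * (w₁ * w₃ * D13 * (((d₁ : ℝ) + d₃ - 2 * e) * ((d₁ : ℝ) + d₃ - e - d₀) * ((d₃ : ℝ) - e) * ((d₁ : ℝ) + d₃ - e - d₂) * ((d₃ : ℝ) - d₀) * ((d₁ : ℝ) + d₃ - d₀ - d₂) * ((d₁ : ℝ) - d₀) * ((d₂ : ℝ) - d₁))) ^ ((e + d₃)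 - d₁ - d₂))) := by
    have W : 0 < (w₁ * w₂ * w₃) ^ (d₁ - e + (e + d₃ - (d₁ + d₂))) := by positivity
    have h := mul_lt_mul_of_pos_left hpair W
    have hq' : e + d₃ - d₁ - d₂ = e + d₃ - (d₁ + d₂) := by omega
    rw [hq']
    generalize (((d₁ : ℝ) + d₂ - 2 * e) * ((d₁ : ℝ) + d₂ - e - d₀) * ((d₂ : ℝ) - e) * ((d₂ : ℝ) - d₀) * ((d₁ : ℝ) - d₀) * ((d₁ : ℝ) + d₂ - d₀ - d₃) * ((d₃ : ℝ) - d₂) * ((d₃ : ℝ) - d₁)) = PB at h ⊢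
    generalize (((d₂ : ℝ) - e) * ((d₂ : ℝ) - d₀) * ((d₂ : ℝ) - d₁) * ((e : ℝ) + d₂ - d₀ - d₁) * ((e : ℝ) - d₀) * ((e : ℝ) + d₂ - d₀ - d₃) * ((d₁ : ℝ) + d₃ - e - d₂) * ((d₃ : ℝ) - e)) = PA at h ⊢
    generalize (((d₃ : ℝ) - e) * ((d₃ : ℝ) - d₀) * ((d₃ : ℝ) - d₁) * ((e : ℝ) + d₃ - d₀ - d₁) * ((e : ℝ) + d₃ - d₀ - d₂) * ((e : ℝ) - d₀) * ((d₁ : ℝ) - e) * ((d₂ : ℝ) - e)) = PC at h ⊢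
    generalize (((d₃ : ℝ) - e) * ((d₃ : ℝ) - d₀) * ((d₃ : ℝ) - d₁) * ((d₃ : ℝ) - d₂) * ((e : ℝ) + d₃ - d₀ - d₁) * ((e : ℝ) + d₃ - d₀ - d₂) * ((e : ℝ) - d₀) * ((d₂ : ℝ) - e)) = QB at h ⊢
    generalize (((d₁ : ℝ) + d₂ - 2 * e) * ((d₁ : ℝ) + d₂ - e - d₀) * ((d₂ : ℝ) - e) * ((d₁ : ℝ) - e) * ((d₂ : ℝ) - d₀) * ((d₁ : ℝ) - d₀) * ((d₁ : ℝ) + d₂ - d₀ - d₃) * ((d₃ : ℝ) - d₁)) = QA at h ⊢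
    generalize (((d₁ : ℝ) + d₃ - 2 * e) * ((d₁ : ℝ) + d₃ - e - d₀) * ((d₃ : ℝ) - e) * ((d₁ : ℝ) + d₃ - e - d₂) * ((d₃ : ℝ) - d₀) * ((d₁ : ℝ) + d₃ - d₀ - d₂) * ((d₁ : ℝ) - d₀) * ((d₂ : ℝ) - d₁)) = QC at h ⊢
    generalize -m₂ = n₂ at h ⊢
    generalize -m₃ = n₃ at h ⊢
    generalize e + d₃ - (d₁ + d₂) = q at h ⊢
    generalize d₁ - e = p at h ⊢
    rw [Nat.add_comm q p]
    generalize ((p + q : ℕ) : ℝ) = S at h ⊢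
    generalize ((p : ℕ) : ℝ) = P at h ⊢
    generalize ((q : ℕ) : ℝ) = Q at h ⊢
    convert h using 1 <;> first | rfl | ring
  exact elevenNomial_chamberC_C3_le_eight e d₀ d₁ d₂ d₃ h0e he1 h12 h23 hC5 hC6 dJ m₀ m₁ m₂ m₃ w₀ w₁ w₂ w₃ D01 D02 D03 D12 D13 D23
    hw₁ hw₂ hw₃ hD12 hD13 (lt_of_mul_lt_mul_left (key.trans_le (mul_le_mul_of_nonneg_right hN hR2)) hL1)

/-- **Rank-one `(2,4)₁`, split 1/3, chamber (C): `Z₊ ≤ 8` under the weight-free circuit pair «N12 ∨ C₃»** (matrix form; `J` any real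
`2 × 2` matrix, letters `1, 2` and `1, 3` not parallel, letters `2, 3` core). [this file] -/
theorem oneThree_rankOne_posRoots_le_eight_of_N12C3 (e d₀ d₁ d₂ d₃ : ℕ) (h0e : d₀ < e) (he1 : e < d₁) (h12 : d₁ < d₂) (h23 : d₂ < d₃)
    (hC1 : d₀ + d₁ < 2 * e) (hC2 : 2 * e < d₀ + d₂) (hC3 : d₀ + d₂ < e + d₁) (hC4 : e + d₁ < d₀ + d₃) (hC5 : d₀ + d₃ < e + d₂) (hC6 : d₁ + d₂ < e + d₃)
    (J : Matrix (Fin 2) (Fin 2) ℝ) (v₀ v₁ v₂ v₃ : Fin 2 → ℝ) (w₀ w₁ w₂ w₃ : ℝ) (hw₁ : 0 < w₁) (hw₂ : 0 < w₂) (hw₃ : 0 < w₃)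
    (hm₂ : (J 0 0 * v₂ 1 ^ 2 + J 1 1 * v₂ 0 ^ 2 - (J 0 1 + J 1 0) * (v₂ 0 * v₂ 1)) < 0)
    (hm₃ : (J 0 0 * v₃ 1 ^ 2 + J 1 1 * v₃ 0 ^ 2 - (J 0 1 + J 1 0) * (v₃ 0 * v₃ 1)) < 0)
    (hD12 : 0 < (v₁ 0 * v₂ 1 - v₁ 1 * v₂ 0) ^ 2) (hD13 : 0 < (v₁ 0 * v₃ 1 - v₁ 1 * v₃ 0) ^ 2)
    (hpair : (((v₁ 0 * v₂ 1 - v₁ 1 * v₂ 0) ^ 2 * (((d₁ : ℝ) + d₂ - 2 * e) * ((d₁ : ℝ) + d₂ - e - d₀) * ((d₂ : ℝ) - e) * ((d₂ : ℝ) - d₀) * ((d₁ : ℝ) - d₀) * ((d₁ : ℝ) + d₂ - d₀ - d₃) * ((d₃ : ℝ) - d₂) * ((d₃ : ℝ) - d₁))) ^ (d₁ - e + (e + d₃ - (d₁ + d₂)))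
          * ((((e + d₃ - (d₁ + d₂) : ℕ) : ℝ)) ^ (e + d₃ - (d₁ + d₂)) * (((d₁ - e : ℕ) : ℝ)) ^ (d₁ - e)))
        * (((-(J 0 0 * v₃ 1 ^ 2 + J 1 1 * v₃ 0 ^ 2 - (J 0 1 + J 1 0) * (v₃ 0 * v₃ 1))) * (((d₃ : ℝ) - e) * ((d₃ : ℝ) - d₀) * ((d₃ : ℝ) - d₁) * ((d₃ : ℝ) - d₂) * ((e : ℝ) + d₃ - d₀ - d₁) * ((e : ℝ) + d₃ - d₀ - d₂) * ((e : ℝ) - d₀) * ((d₂ : ℝ) - e))) ^ (d₁ - e + (e + d₃ - (d₁ + d₂)))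
          * ((((e + d₃ - (d₁ + d₂) : ℕ) : ℝ)) ^ (e + d₃ - (d₁ + d₂)) * (((d₁ - e : ℕ) : ℝ)) ^ (d₁ - e)))
      < ((((d₁ - e + (e + d₃ - (d₁ + d₂)) : ℕ) : ℝ)) ^ (d₁ - e + (e + d₃ - (d₁ + d₂)))
          * (((-(J 0 0 * v₂ 1 ^ 2 + J 1 1 * v₂ 0 ^ 2 - (J 0 1 + J 1 0) * (v₂ 0 * v₂ 1))) * (((d₂ : ℝ) - e) * ((d₂ : ℝ) - d₀) * ((d₂ : ℝ) - d₁) * ((e : ℝ) + d₂ - d₀ - d₁) * ((e : ℝ) - d₀) * ((e : ℝ) + d₂ - d₀ - d₃) * ((d₁ : ℝ) + d₃ - e - d₂) * ((d₃ : ℝ) - e))) ^ (e + d₃ - (d₁ + d₂))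
            * ((-(J 0 0 * v₃ 1 ^ 2 + J 1 1 * v₃ 0 ^ 2 - (J 0 1 + J 1 0) * (v₃ 0 * v₃ 1))) * (((d₃ : ℝ) - e) * ((d₃ : ℝ) - d₀) * ((d₃ : ℝ) - d₁) * ((e : ℝ) + d₃ - d₀ - d₁) * ((e : ℝ) + d₃ - d₀ - d₂) * ((e : ℝ) - d₀) * ((d₁ : ℝ) - e) * ((d₂ : ℝ) - e))) ^ (d₁ - e)))
        * ((((d₁ - e + (e + d₃ - (d₁ + d₂)) : ℕ) : ℝ)) ^ (d₁ - e + (e + d₃ - (d₁ + d₂)))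
          * (((v₁ 0 * v₂ 1 - v₁ 1 * v₂ 0) ^ 2 * (((d₁ : ℝ) + d₂ - 2 * e) * ((d₁ : ℝ) + d₂ - e - d₀) * ((d₂ : ℝ) - e) * ((d₁ : ℝ) - e) * ((d₂ : ℝ) - d₀) * ((d₁ : ℝ) - d₀) * ((d₁ : ℝ) + d₂ - d₀ - d₃) * ((d₃ : ℝ) - d₁))) ^ (d₁ - e)
            * ((v₁ 0 * v₃ 1 - v₁ 1 * v₃ 0) ^ 2 * (((d₁ : ℝ) + d₃ - 2 * e) * ((d₁ : ℝ) + d₃ - e - d₀) * ((d₃ : ℝ) - e) * ((d₁ : ℝ) + d₃ - e - d₂) * ((d₃ : ℝ) - d₀) * ((d₁ : ℝ) + d₃ - d₀ - d₂) * ((d₁ : ℝ) - d₀) * ((d₂ : ℝ) - d₁))) ^ (e + d₃ - (d₁ + d₂))))) :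
    ((Matrix.det (((X : ℝ[X]) ^ e) • J.map Polynomial.C
        + (Polynomial.C w₀ * X ^ d₀) • (vecMulVec v₀ v₀).map Polynomial.C
        + (Polynomial.C w₁ * X ^ d₁) • (vecMulVec v₁ v₁).map Polynomial.C
        + (Polynomial.C w₂ * X ^ d₂) • (vecMulVec v₂ v₂).map Polynomial.C
        + (Polynomial.C w₃ * X ^ d₃) • (vecMulVec v₃ v₃).map Polynomial.C)).roots.toFinset.filter (fun t => 0 < t)).card
      ≤ 8 := by
  rw [det_rankOne_four_sum]
  exact elevenNomial_chamberC_N12C3_le_eight e d₀ d₁ d₂ d₃ h0e he1 h12 h23 hC1 hC2 hC3 hC4 hC5 hC6 J.det _ _ _ _ w₀ w₁ w₂ w₃ _ _ _ _ _ _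
    hw₁ hw₂ hw₃ hm₂ hm₃ hD12 hD13 hpair

end Summit.ValiantsHypothesis.ValiantsHypothesis.Theorems.LacunarySymmetroidMatrixDescartes.Pivot.TwoDirections.BlockLaw
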